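import Summits.QuantumFields.BalabanUV.T4Continuum.Support.B13StepSecantEnd
import Summits.QuantumFields.BalabanUV.T4Continuum.Support.B13TermHistSecantDecay
import Summits.QuantumFields.BalabanUV.T4Continuum.Support.B13StepOfRecord
import Summits.QuantumFields.BalabanUV.T4Continuum.Support.OutputRateArithmetic

/-!
# NE5 ∕ U3 — the SECANT END FACE ON BAŁABAN's CARRIERS OF RECORD with the HISTORY HALF of W2 reduced to per-activity binders
# of printed KIND: leaf-03's `B13StepSecantEnd` ∕ `B13TermHistSecantDecay` composed at the model of record `B13StepOfRecord.step`,
# the three polymer-geometry side conditions DISCHARGED by P2's theorems (`loc_b13`, `reach_b13` (ν = 9), `ineq227_level` (c = 5))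

Cell `pub-balaban`, unit `b2b-balaban-t4-ne5-formalise-leaf-01` (NE5 formalisation swarm, LEAF PROVER 01, gen 3; journal INTENT
`B13StepOfRecordSecantEnd`, taking leaf-03-g2's OFFER l.7501; companion `Support/B13StepOfRecordActNorm` p210812).  Summits-side NEW
WORK under the LEAN PLACEMENT RULE (cell bookkeeping; NOT a Literature module; NO owner END-face module is edited — a NEW module
applying the landed END face `T4InputCauchyRateSecant.ne5_at_of_stepModel_secant_scale_nat` BY NAME, exactly as leaf-03's
`B13StepSecantEnd.ne5_of_assembly_secant` p210428 does for the generic assembly).  HONEST FRAMING: rung (B)+1 of the FINITE-VOLUME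
T⁴ continuum programme — NOT infinite volume, NOT a mass gap, NOT the Clay problem, and **NOT A PROOF OF NE5**: the END below is an
IMPLICATION whose wall binders (W2-op = `OpLipschitz`, cell GAPS G-ne5p1-1′, NOT PRINTED; the per-activity structure ∕ exponent
bounds ∕ absolute majorants of the (2.14)-terms with their decay split and anchored norm — (2.14)∕(2.15)∕(2.38), (2.18)∕(2.20),
(1.26)∕(2.41) KIND, NOT PRINTED as class statements; W1 in row NE2's entry currency; W4; the one-run slice budgets — W3 KIND; the
one-run levels L05∕L06 — quoted SHAPES of [Balaban1987RG1] (1.18) p. 263; the transport reading; the numerics) are DISPLAYED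
HYPOTHESES, asserted nowhere.  HONEST DEPENDENCY (cell line, verbatim): continuum YM on T⁴ ⇐ BetaPertH ∧ nine spine estimates
(0/9 proved); BetaPertH ⇐ (D1) ∧ (D4) ∧ CAP+tail; G-an2-4 gates asym, D1 and NE2/3/4.

WHAT THIS FILE DOES.  On the MODEL OF RECORD `B13StepOfRecord.step S E₀ cB = (assembly S).step ((assembly S).bHist E₀ cB)` (leaf-09,
p208933; term indexing `labelsIndexing (B13DomainGeometryTR.domainGeometry R) (b13InnerData R)` and hard core `touchInc …` OF RECORD):
* §1 **`histSecant_step_of_actNormDecay`** — the history secant `HistSecant (step S E₀ cB) K W κ (2·N̄·Φ′/(1 − 36Φ′)²)` from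
  leaf-08's STRUCTURE `ActExpLinearOn` of `S.act`, the displayed per-activity exponent bounds `0 ≤ N ≤ N̄` (history margins
  `S.rHist`), absolute majorants `A` of the factors with a factorwise decay split `A ≤ A′·e^{−κ(d(Z)+5)}` (κ ≥ 0) and the anchored
  exponential norm `Φ′` of `A′` on every `R.domAt k` with `36Φ′ < 1` — leaf-03's `B13TermHistSecantDecay.histSecant_socket_of_actNormDecay`
  (p210690) with `hM := rfl` and with footprint locality, reach (ν = 9) and (2.27) (c = 5) DISCHARGED by `B13DomainGeometryTR.loc_b13` ∕
  `reach_b13` ∕ `ineq227_level`; **`histFibreEnvelopeCl_step_of_actNormDecay`** — the Cauchy face likewise (slack from ROOM by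
  leaf-09's `Assembly.boxInClass`), `HistFibreEnvelopeCl (step S E₀ cB) W κ (Φ′/(1 − 36Φ′))`.
* §2 **`ne5_of_record_secant_actNormDecay`** — the owner's secant END applied at the assembly of record with `hsec := §1`:
  conclusion LITERALLY `NE5 (B13StepOfRecord.outA S E₀ cB) (B13StepOfRecord.outB S E₀ cB) W κ θ′ C₅` with
  `G₁ := N̄·Φ′/(1 − 36Φ′)²` in `C₅ = (Λop·(c₁/r₀) + 2G₁·δ′ + B)(θ′ − ω)/(θ′ − (ω + 2G₁·cA))`; the proof is leaf-03's
  `ne5_of_assembly_secant` line by line (`Assembly.inBase`, `operatorRate_of_weightedEntrywise`, `histPairInClass_ballClass` with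
  `B13StepSecantEnd.histBudgetA`, `insAffine`∕`insBlind`∕`insHomog`∕`insScaleBound` BY NAME).
* §3 `exists_ne5_of_record_secant_actNormDecay` — the same with leaf L10's letters `k₀`, `B` ELIMINATED (`0 < θ < 1`, `0 < ρ₀`;
  leaf-10's `OutputRateArithmetic.reach_scale_exists` ∕ `OutputRateResidual.first_scales_const` BY NAME): `∃ C₅, NE5 … θ′ C₅`.
CENSUS VALUE: compared with `B13StepSecantEnd.ne5_of_assembly_secant` on the generic assembly, the binders `hconv` (d3's convergence)
and `hmom` (the per-domain first-moment budget) are GONE — replaced by per-activity data of printed KIND (`N̄`, the decay split,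
the anchored norm `Φ′`, `36Φ′ < 1`) — and NO geometric binder appears: on Bałaban's carriers of record locality, reach and (2.27) are
theorems.  What REMAINS displayed along the secant route on the carriers of record is read off the binder list of §2.
Nothing is asserted about [II]'s kernels ∕ potentials ∕ terms (the `Slots` stay PARAMETERS); 0 sorry; axioms ⊆ {propext,
Classical.choice, Quot.sound}.
-/

noncomputable section

open scoped BigOperators
open Metric Set

namespace Summit.QuantumFields.BalabanUV.T4Continuum.B13StepOfRecordSecantEnd

open Literature.MathematicalPhysics.QuantumFieldTheory.Balaban1983to89
open Literature.MathematicalPhysics.QuantumFieldTheory.Balaban1983to89.T4OutputRate (Carriers Functional DecayBound NE5)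
open Literature.MathematicalPhysics.QuantumFieldTheory.Balaban1983to89.T4InputCauchyRateData (StepModel)
open Literature.MathematicalPhysics.QuantumFieldTheory.Balaban1983to89.T4InputCauchyRateSpecies (ballClass BaseBudget OpLipschitz)
open Literature.MathematicalPhysics.QuantumFieldTheory.Balaban1983to89.T4InputCauchyRateTermwise (HistFibreEnvelopeCl)
open Literature.MathematicalPhysics.QuantumFieldTheory.Balaban1983to89.T4InputCauchyRateSecant
  (HistSecant HistBudgetA HistPairInClass histPairInClass_ballClass ne5_at_of_stepModel_secant_scale_nat)
open Summit.QuantumFields.BalabanUV.T4Continuum.B13Carriers (TwoRuns)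
open Summit.QuantumFields.BalabanUV.T4Continuum.B13OpDatum (OpDatum)
open Summit.QuantumFields.BalabanUV.T4Continuum.B13OpDatumJunctions (RawBounded WeightedEntrywiseRate)
open Summit.QuantumFields.BalabanUV.T4Continuum.B13StepTermLabels (TermIdx InnerLabel)
open Summit.QuantumFields.BalabanUV.T4Continuum.B13StepTermFamily (ActData ActExpLinearOn)
open Summit.QuantumFields.BalabanUV.T4Continuum.B13StepTermSocket (labelsIndexing touchInc)
open Summit.QuantumFields.BalabanUV.T4Continuum.B13InnerData (Bnd b13InnerData)
open Summit.QuantumFields.BalabanUV.T4Continuum.B13ActMajorantLevels (polyWeight)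
open Summit.QuantumFields.BalabanUV.T4Continuum.UrsellTreeSum (ind)
open Summit.QuantumFields.BalabanUV.T4Continuum.B13Base (selfCtr)
open Summit.QuantumFields.BalabanUV.T4Continuum.B13Represents (Assembly)
open Summit.QuantumFields.BalabanUV.T4Continuum.B13TermHistSecant (ActExpNormBound ActAbsBound)
open Summit.QuantumFields.BalabanUV.T4Continuum.B13TermHistSecantDecay
  (histSecant_socket_of_actNormDecay histFibreEnvelopeCl_socket_of_actNormDecay)
open Summit.QuantumFields.BalabanUV.T4Continuum.B13StepSecantEnd (histBudgetA)
open Summit.QuantumFields.BalabanUV.T4Continuum.B13DomainGeometryTR (SCube footprint reach loc_b13 reach_b13 ineq227_level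
  domainGeometry)
open Summit.QuantumFields.BalabanUV.T4Continuum.B13StepOfRecord (Slots assembly step outA outB)

variable {G : Type} [GaugeGroup G] {R : TwoRuns G} {E IOp Hist Ω : Type*} [NormedAddCommGroup Hist] [NormedSpace ℂ Hist]
  [MeasurableSpace Ω] (S : Slots R E IOp Hist) (E₀ cB : ℝ)

/-! ## §1 The two producers of L04-hist ON THE MODEL OF RECORD at the printed kind of rate, geometry by theorem -/

/-- [folklore] **THE HISTORY SECANT ON THE MODEL OF RECORD from per-activity data, all geometry DISCHARGED.**  leaf-03's
`histSecant_socket_of_actNormDecay` at `M := B13StepOfRecord.step S E₀ cB` (`hM := rfl`), with `h227 := ineq227_level` (c = 5),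
`hloc := loc_b13`, `hreach := reach_b13` (ν = 9): structure `ActExpLinearOn` of `S.act` on the class `K`, exponent bounds
`0 ≤ N ≤ N̄` in units `S.rHist`, absolute majorants `A` with decay split against `A′` and anchored exponential norm `Φ′` of `A′`,
`36Φ′ < 1` ⟹ `HistSecant (step S E₀ cB) K W κ (2·(N̄·Φ′/(1 − 36Φ′)²))`. -/
theorem histSecant_step_of_actNormDecay {K : ℕ → (ℕ → ℝ) → R.carriers.BgB → Set (OpDatum E × Hist)} {W : Set (ℕ → ℝ)}
    {N A A' : ℕ → (ℕ → ℝ) → R.carriers.BgB → R.carriers.Dom → InnerLabel R.carriers.Dom (Bnd R) → ℝ} {Nbar κ Φ' : ℝ}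
    {Dt : ActData R.carriers.Dom (InnerLabel R.carriers.Dom (Bnd R)) (OpDatum E) Hist Ω} (hκ : 0 ≤ κ)
    (hexp : ActExpLinearOn (labelsIndexing (domainGeometry R) (b13InnerData R)) S.act Dt K W)
    (hN : ActExpNormBound (labelsIndexing (domainGeometry R) (b13InnerData R)) Dt K W (step S E₀ cB).rHist N)
    (hN0 : ∀ k g U Z ℓ, 0 ≤ N k g U Z ℓ) (hNle : ∀ k g U Z ℓ, N k g U Z ℓ ≤ Nbar) (hNbar : 0 ≤ Nbar)
    (habs : ActAbsBound (labelsIndexing (domainGeometry R) (b13InnerData R)) Dt K W A)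
    (hA0 : ∀ k g U Z ℓ, 0 ≤ A k g U Z ℓ) (hA0' : ∀ k g U Z ℓ, 0 ≤ A' k g U Z ℓ)
    (hdec : ∀ k g U Z ℓ, A k g U Z ℓ ≤ A' k g U Z ℓ * Real.exp (-(κ * (R.carriers.d Z + 5))))
    (hΦ0 : 0 ≤ Φ') (hsmall : 36 * Φ' < 1)
    (hΦ : ∀ k, ∀ g ∈ W, ∀ (U : R.carriers.BgB) (q : SCube R),
      ∑ Z ∈ R.domAt k, ind (q ∈ footprint Z) * polyWeight (b13InnerData R) (A' k g U) k Z *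
        Real.exp ((footprint Z).card) ≤ Φ') :
    HistSecant (step S E₀ cB) K W κ (2 * (Nbar * (Φ' / (1 - 36 * Φ') ^ 2))) := by
  have h := histSecant_socket_of_actNormDecay (G := domainGeometry R) (D := b13InnerData R) (act := S.act)
    (M := step S E₀ cB) (K := K) (W := W) (N := N) (𝒜 := A) (𝒜' := A') (ν := 9) (Φ' := Φ') (c := 5)
    (fun _ _ _ _ => rfl) hκ (by norm_num : (0 : ℝ) ≤ 5) hexp hN hN0 hNle
    hNbar habs hA0 hA0' hdec (fun X => ineq227_level X) reach (fun Z Z' h => loc_b13 Z Z' h) (by norm_num) reach_b13 hΦ0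
    (by linarith) hΦ
  have h36 : (4 : ℝ) * 9 * Φ' = 36 * Φ' := by ring
  rwa [h36] at h

/-- [folklore] **THE CAUCHY FACE ON THE MODEL OF RECORD at the printed kind of rate, all geometry DISCHARGED.**  leaf-03's
`histFibreEnvelopeCl_socket_of_actNormDecay` at the model of record on the budget ball class `ballClass (selfCtr raw histRef) ROp
RHist`, the slack supplied from ROOM by leaf-09's `Assembly.boxInClass` (`rOp ≤ ROp`, `bHist + rHist ≤ RHist`): the (2.38)-KIND norm
majorant `A` of `S.act` with decay split and anchored norm `Φ′` of `A′` (`36Φ′ < 1`) and the structure `ActExpLinearOn` ⟹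
`HistFibreEnvelopeCl (step S E₀ cB) W κ (Φ′/(1 − 36Φ′))`. -/
theorem histFibreEnvelopeCl_step_of_actNormDecay {W : Set (ℕ → ℝ)} {ROp RHist : ℕ → ℝ}
    {A A' : ℕ → (ℕ → ℝ) → R.carriers.BgB → R.carriers.Dom → InnerLabel R.carriers.Dom (Bnd R) → ℝ} {κ Φ' : ℝ}
    {Dt : ActData R.carriers.Dom (InnerLabel R.carriers.Dom (Bnd R)) (OpDatum E) Hist Ω} (hκ : 0 ≤ κ)
    (hOp : ∀ k, (assembly S).rOp k ≤ ROp k) (hHist : ∀ k, (assembly S).bHist E₀ cB k + (assembly S).rHist k ≤ RHist k)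
    (hA : ∀ k, ∀ g ∈ W, ∀ (U : R.carriers.BgB) (q : OpDatum E × Hist),
      q ∈ ballClass (selfCtr (assembly S).raw (assembly S).histRef) ROp RHist k g U → ∀ X : R.carriers.Dom,
      R.carriers.scale X = k → ∀ i : TermIdx R.carriers.Dom (Bnd R),
        (labelsIndexing (domainGeometry R) (b13InnerData R)).Rel k i X →
        ∀ m, ‖S.act ((labelsIndexing (domainGeometry R) (b13InnerData R)).poly i m)
              ((labelsIndexing (domainGeometry R) (b13InnerData R)).lab i m) q.1 q.2‖ ≤
          A k g U ((labelsIndexing (domainGeometry R) (b13InnerData R)).poly i m)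
            ((labelsIndexing (domainGeometry R) (b13InnerData R)).lab i m))
    (hA0 : ∀ k g U Z ℓ, 0 ≤ A k g U Z ℓ) (hA0' : ∀ k g U Z ℓ, 0 ≤ A' k g U Z ℓ)
    (hdec : ∀ k g U Z ℓ, A k g U Z ℓ ≤ A' k g U Z ℓ * Real.exp (-(κ * (R.carriers.d Z + 5))))
    (hΦ0 : 0 ≤ Φ') (hsmall : 36 * Φ' < 1)
    (hΦ : ∀ k, ∀ g ∈ W, ∀ (U : R.carriers.BgB) (q : SCube R),
      ∑ Z ∈ R.domAt k, ind (q ∈ footprint Z) * polyWeight (b13InnerData R) (A' k g U) k Z *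
        Real.exp ((footprint Z).card) ≤ Φ')
    (hexp : ActExpLinearOn (labelsIndexing (domainGeometry R) (b13InnerData R)) S.act Dt
      (ballClass (selfCtr (assembly S).raw (assembly S).histRef) ROp RHist) W) :
    HistFibreEnvelopeCl (step S E₀ cB) W κ (Φ' / (1 - 36 * Φ')) := by
  have h := histFibreEnvelopeCl_socket_of_actNormDecay (G := domainGeometry R) (D := b13InnerData R) (act := S.act)
    (M := step S E₀ cB) (W := W) (𝒜 := A) (𝒜' := A') (ν := 9) (Φ' := Φ') (c := 5) (fun _ _ _ _ => rfl) hκ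
    (by norm_num : (0 : ℝ) ≤ 5)
    ((assembly S).boxInClass ((assembly S).bHist E₀ cB) W hOp hHist) hA hA0 hA0' hdec (fun X => ineq227_level X) reach
    (fun Z Z' h => loc_b13 Z Z' h) (by norm_num) reach_b13 hΦ0 (by linarith) hΦ hexp
  have h36 : (4 : ℝ) * 9 * Φ' = 36 * Φ' := by ring
  rwa [h36] at h

/-! ## §2 The secant END face ON THE CARRIERS OF RECORD -/

/-- [folklore] **THE SECANT END FACE ON BAŁABAN's CARRIERS OF RECORD, HISTORY HALF AT ACTIVITY LEVEL.**  leaf-03's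
`B13StepSecantEnd.ne5_of_assembly_secant` at `𝔄 := B13StepOfRecord.assembly S` with `hsec := histSecant_step_of_actNormDecay`:
the transport READING; the DISPLAYED one-run slice budgets of both runs (W3 KIND); the quoted levels L05∕L06; the DISPLAYED weighted
entrywise two-run species rate `c₁·θ^k` with bounded raw suppliers and margin floor `r₀` (W1, row NE2's currency); the DISPLAYED
insertion rate `δ′` (W4); the DISPLAYED operator-species two-point modulus `OpLipschitz κ Λop ρ₀` (W2-op, wall); leaf-08's STRUCTURE
`ActExpLinearOn` of `S.act` on the budget ball class with the DISPLAYED per-activity exponent bounds `0 ≤ N ≤ N̄` (units `S.rHist`),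
absolute majorants `A` with decay split `A ≤ A′·e^{−κ(d(Z)+5)}` and anchored exponential norm `Φ′` of `A′` on every `R.domAt k`,
`36Φ′ < 1`; the RADII `(c₁∕r₀)·rOp ≤ ROp`, `bHist E₀ cB ≤ RHist`, `δ′·rHist + EA₀·rHist·cA∕(1 − ω) ≤ RHist`; the numerics (operator
reach `(c₁∕r₀)·θ^{k₀} ≤ ρ₀`, first scales `B`, smallness `ω + 2G₁·cA < θ′` with `G₁ := N̄·Φ′/(1 − 36Φ′)²`) IMPLY
`NE5 (outA S E₀ cB) (outB S E₀ cB) W κ θ′ ((Λop·(c₁∕r₀) + 2G₁·δ′ + B)(θ′ − ω)∕(θ′ − (ω + 2G₁·cA)))`.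
NO geometric binder and NO d3∕first-moment budget binder remains (theorems on the carriers of record ∕ produced from the anchored
norm).  NOT a proof of NE5: an implication from displayed binders. -/
theorem ne5_of_record_secant_actNormDecay {W : Set (ℕ → ℝ)} {ROp RHist : ℕ → ℝ}
    {N A A' : ℕ → (ℕ → ℝ) → R.carriers.BgB → R.carriers.Dom → InnerLabel R.carriers.Dom (Bnd R) → ℝ}
    {Dt : ActData R.carriers.Dom (InnerLabel R.carriers.Dom (Bnd R)) (OpDatum E) Hist Ω}
    {κ Λop Nbar Φ' EA₀ E₁ cA c₁ r₀ δ' θ θ' ρ₀ B : ℝ} {k₀ : ℕ}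
    (hT : (assembly S).TransportReads W)
    (hbB : (assembly S).SliceBudgetB W κ cB) (hbA : S.D.SliceBudget (step S E₀ cB) W κ cA)
    (hdA : DecayBound (outA S E₀ cB) W EA₀ κ) (hdB : DecayBound (outB S E₀ cB) W E₀ κ)
    (hRA : RawBounded S.F (assembly S).rawAt W) (hRB : RawBounded S.F S.rawB W)
    (hwer : WeightedEntrywiseRate S.F (assembly S).rawAt S.rawB W c₁ fun k => θ ^ k) (hfl : ∀ k, r₀ ≤ S.rOp k)
    (hins : (step S E₀ cB).InsertionRate W κ E₀ δ' θ)
    (hopL : OpLipschitz (step S E₀ cB) W κ Λop ρ₀)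
    (hexp : ActExpLinearOn (labelsIndexing (domainGeometry R) (b13InnerData R)) S.act Dt
      (ballClass (selfCtr (assembly S).raw (assembly S).histRef) ROp RHist) W)
    (hN : ActExpNormBound (labelsIndexing (domainGeometry R) (b13InnerData R)) Dt
      (ballClass (selfCtr (assembly S).raw (assembly S).histRef) ROp RHist) W S.rHist N)
    (hN0 : ∀ k g U Z ℓ, 0 ≤ N k g U Z ℓ) (hNle : ∀ k g U Z ℓ, N k g U Z ℓ ≤ Nbar) (hNbar : 0 ≤ Nbar)
    (habs : ActAbsBound (labelsIndexing (domainGeometry R) (b13InnerData R)) Dt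
      (ballClass (selfCtr (assembly S).raw (assembly S).histRef) ROp RHist) W A)
    (hA0 : ∀ k g U Z ℓ, 0 ≤ A k g U Z ℓ) (hA0' : ∀ k g U Z ℓ, 0 ≤ A' k g U Z ℓ) (hκ : 0 ≤ κ)
    (hdec : ∀ k g U Z ℓ, A k g U Z ℓ ≤ A' k g U Z ℓ * Real.exp (-(κ * (R.carriers.d Z + 5))))
    (hΦ0 : 0 ≤ Φ') (hΦsmall : 36 * Φ' < 1)
    (hΦ : ∀ k, ∀ g ∈ W, ∀ (U : R.carriers.BgB) (q : SCube R),
      ∑ Z ∈ R.domAt k, ind (q ∈ footprint Z) * polyWeight (b13InnerData R) (A' k g U) k Z *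
        Real.exp ((footprint Z).card) ≤ Φ')
    (hOp : ∀ k, c₁ / r₀ * S.rOp k ≤ ROp k) (hHist : ∀ k, (assembly S).bHist E₀ cB k ≤ RHist k)
    (hHistA : ∀ k, δ' * S.rHist k + EA₀ * (S.rHist k * (cA / (1 - S.D.ω))) ≤ RHist k)
    (hEA₀ : 0 ≤ EA₀) (hE₀ : 0 ≤ E₀) (hE₁ : 0 < E₁) (hΛop : 0 ≤ Λop) (hcA : 0 ≤ cA) (hcB : 0 ≤ cB)
    (hc₁ : 0 ≤ c₁) (hr₀ : 0 < r₀) (hδ' : 0 ≤ δ') (hθ : 0 ≤ θ) (hθθ' : θ ≤ θ') (hθ'1 : θ' ≤ 1) (hω : 0 < S.D.ω)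
    (hω1 : S.D.ω < 1) (hreach : c₁ / r₀ * θ ^ k₀ ≤ ρ₀) (hB : 0 ≤ B) (hfirst : ∀ k < k₀, EA₀ + E₀ ≤ B * θ ^ k)
    (hsmall : S.D.ω + 2 * (Nbar * (Φ' / (1 - 36 * Φ') ^ 2)) * cA < θ') :
    NE5 (outA S E₀ cB) (outB S E₀ cB) W κ θ'
      ((Λop * (c₁ / r₀) + 2 * (Nbar * (Φ' / (1 - 36 * Φ') ^ 2)) * δ' + B) * (θ' - S.D.ω) /
        (θ' - (S.D.ω + 2 * (Nbar * (Φ' / (1 - 36 * Φ') ^ 2)) * cA))) := by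
  -- abbreviations of the assembly of record
  have hG₁ : 0 ≤ Nbar * (Φ' / (1 - 36 * Φ') ^ 2) := mul_nonneg hNbar (div_nonneg hΦ0 (sq_nonneg _))
  have hbase := Assembly.inBase (𝔄 := assembly S) hbB hdB hE₀ hcB hω.le hω1
  have hop := Assembly.operatorRate_of_weightedEntrywise (𝔄 := assembly S) (BHist := (assembly S).bHist E₀ cB)
    hRA hRB hwer hc₁ hθ hfl hr₀
  have hpair : HistPairInClass (step S E₀ cB) (ballClass (selfCtr (assembly S).raw (assembly S).histRef) ROp RHist)
      (outA S E₀ cB) (outB S E₀ cB) W :=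
    histPairInClass_ballClass hbase ((assembly S).baseBudget _ W)
      (histBudgetA (assembly S) _ hbA hdA hins hEA₀ hE₀ hcA hδ' hθ (hθθ'.trans hθ'1) hω.le hω1) hop
      (div_nonneg hc₁ hr₀.le) hθ (hθθ'.trans hθ'1) (fun k => by rw [Pi.zero_apply, zero_add]; exact hOp k) hHist hHistA
  have hsec := histSecant_step_of_actNormDecay S E₀ cB hκ hexp hN hN0 hNle hNbar habs hA0 hA0' hdec hΦ0 hΦsmall hΦ
  exact ne5_at_of_stepModel_secant_scale_nat (step S E₀ cB) ((assembly S).representsA _ hT) ((assembly S).representsB _ W)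
    hbase hpair hopL hsec hdA hdB hop hins ((assembly S).insAffine _ W) ((assembly S).insBlind _ W)
    ((assembly S).insHomog _ W) (Assembly.insScaleBound hbA hω.le hE₁.le) hE₁ hΛop (by positivity) (div_nonneg hc₁ hr₀.le)
    hδ' hθ hθθ' hθ'1 hcA hω hreach hB hfirst hsmall

/-! ## §3 The reach scale and the first-scales constant ELIMINATED (leaf L10's letters `k₀`, `B` — `OutputRateArithmetic` BY NAME) -/

/-- [folklore] **THE SECANT END ON THE CARRIERS OF RECORD WITHOUT THE L10 LETTERS**: with `0 < θ < 1` and `0 < ρ₀` the operator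
reach scale `k₀` (`(c₁/r₀)·θ^{k₀} ≤ ρ₀`) and the first-scales constant `B` EXIST (leaf-10's `OutputRateArithmetic.reach_scale_exists`,
`OutputRateResidual.first_scales_const`), and the free reference level is set to `E₁ := 1`, so §2 gives `∃ C₅, NE5 (outA S E₀ cB) (outB S E₀ cB) W κ θ′ C₅` from the
remaining binders (the elimination suggested by leaf-10-g3, journal l.7715; the η-UNIFORM form `∃ C₅, ∀ R S W …` is row O6-n's
`B13StepSecantArithmetic`, not here). -/
theorem exists_ne5_of_record_secant_actNormDecay {W : Set (ℕ → ℝ)} {ROp RHist : ℕ → ℝ}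
    {N A A' : ℕ → (ℕ → ℝ) → R.carriers.BgB → R.carriers.Dom → InnerLabel R.carriers.Dom (Bnd R) → ℝ}
    {Dt : ActData R.carriers.Dom (InnerLabel R.carriers.Dom (Bnd R)) (OpDatum E) Hist Ω}
    {κ Λop Nbar Φ' EA₀ cA c₁ r₀ δ' θ θ' ρ₀ : ℝ}
    (hT : (assembly S).TransportReads W)
    (hbB : (assembly S).SliceBudgetB W κ cB) (hbA : S.D.SliceBudget (step S E₀ cB) W κ cA)
    (hdA : DecayBound (outA S E₀ cB) W EA₀ κ) (hdB : DecayBound (outB S E₀ cB) W E₀ κ)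
    (hRA : RawBounded S.F (assembly S).rawAt W) (hRB : RawBounded S.F S.rawB W)
    (hwer : WeightedEntrywiseRate S.F (assembly S).rawAt S.rawB W c₁ fun k => θ ^ k) (hfl : ∀ k, r₀ ≤ S.rOp k)
    (hins : (step S E₀ cB).InsertionRate W κ E₀ δ' θ)
    (hopL : OpLipschitz (step S E₀ cB) W κ Λop ρ₀)
    (hexp : ActExpLinearOn (labelsIndexing (domainGeometry R) (b13InnerData R)) S.act Dt
      (ballClass (selfCtr (assembly S).raw (assembly S).histRef) ROp RHist) W)
    (hN : ActExpNormBound (labelsIndexing (domainGeometry R) (b13InnerData R)) Dt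
      (ballClass (selfCtr (assembly S).raw (assembly S).histRef) ROp RHist) W S.rHist N)
    (hN0 : ∀ k g U Z ℓ, 0 ≤ N k g U Z ℓ) (hNle : ∀ k g U Z ℓ, N k g U Z ℓ ≤ Nbar) (hNbar : 0 ≤ Nbar)
    (habs : ActAbsBound (labelsIndexing (domainGeometry R) (b13InnerData R)) Dt
      (ballClass (selfCtr (assembly S).raw (assembly S).histRef) ROp RHist) W A)
    (hA0 : ∀ k g U Z ℓ, 0 ≤ A k g U Z ℓ) (hA0' : ∀ k g U Z ℓ, 0 ≤ A' k g U Z ℓ) (hκ : 0 ≤ κ)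
    (hdec : ∀ k g U Z ℓ, A k g U Z ℓ ≤ A' k g U Z ℓ * Real.exp (-(κ * (R.carriers.d Z + 5))))
    (hΦ0 : 0 ≤ Φ') (hΦsmall : 36 * Φ' < 1)
    (hΦ : ∀ k, ∀ g ∈ W, ∀ (U : R.carriers.BgB) (q : SCube R),
      ∑ Z ∈ R.domAt k, ind (q ∈ footprint Z) * polyWeight (b13InnerData R) (A' k g U) k Z *
        Real.exp ((footprint Z).card) ≤ Φ')
    (hOp : ∀ k, c₁ / r₀ * S.rOp k ≤ ROp k) (hHist : ∀ k, (assembly S).bHist E₀ cB k ≤ RHist k)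
    (hHistA : ∀ k, δ' * S.rHist k + EA₀ * (S.rHist k * (cA / (1 - S.D.ω))) ≤ RHist k)
    (hEA₀ : 0 ≤ EA₀) (hE₀ : 0 ≤ E₀) (hΛop : 0 ≤ Λop) (hcA : 0 ≤ cA) (hcB : 0 ≤ cB)
    (hc₁ : 0 ≤ c₁) (hr₀ : 0 < r₀) (hδ' : 0 ≤ δ') (hθ0 : 0 < θ) (hθ1 : θ < 1) (hθθ' : θ ≤ θ') (hθ'1 : θ' ≤ 1)
    (hω : 0 < S.D.ω) (hω1 : S.D.ω < 1) (hρ₀ : 0 < ρ₀)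
    (hsmall : S.D.ω + 2 * (Nbar * (Φ' / (1 - 36 * Φ') ^ 2)) * cA < θ') :
    ∃ C₅, NE5 (outA S E₀ cB) (outB S E₀ cB) W κ θ' C₅ := by
  obtain ⟨k₀, hk₀⟩ := OutputRateArithmetic.reach_scale_exists (D := c₁ / r₀) (h := 0) (div_nonneg hc₁ hr₀.le) hθ1 hρ₀
  rw [add_zero] at hk₀
  exact ⟨_, ne5_of_record_secant_actNormDecay S E₀ cB hT hbB hbA hdA hdB hRA hRB hwer hfl hins hopL hexp hN hN0 hNle hNbar habs
    hA0 hA0' hκ hdec hΦ0 hΦsmall hΦ hOp hHist hHistA hEA₀ hE₀ (one_pos : (0 : ℝ) < 1) hΛop hcA hcB hc₁ hr₀ hδ' hθ0.le hθθ' hθ'1 hω hω1 hk₀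
    (le_max_left 0 ((EA₀ + E₀) / θ ^ k₀))
    (fun k hk => OutputRateResidual.first_scales_const hθ0 hθ1.le hk.le) hsmall⟩

end Summit.QuantumFields.BalabanUV.T4Continuum.B13StepOfRecordSecantEnd

end
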